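import Literature.MathematicalPhysics.QuantumFieldTheory.Balaban1983to89.B15Prop1Carrier
import Literature.MathematicalPhysics.QuantumFieldTheory.Balaban1983to89.T4ExpWindowSmallField

/-!
# `Balaban1983to89.B15Prop1ChartSU2` — T. Bałaban, *Large field renormalization. I. The basic step of the 𝐑 operation*,
Commun. Math. Phys. **122** (1989) 175–202 [Balaban1989LargeFieldI] («[IV]»), **Proposition 1** p. 194 / [Balaban1989LargeFieldII]
(«[LF-II]») p. 359 *«we can write V′ = exp iB′»*: THE EXPONENTIAL CHART LETTERS of the Proposition-1 dictionary DISCHARGED AT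
`G = SU(2)` — pv26's exponential chart `expPoint : ℝ³ → SU(2)` / `logVec` (`T4HaarSU2ExpChart`, `T4ExpWindowSmallField`) packaged
as the `B16Sect1Backgrounds.ExpChart` datum the Proposition-1 carrier reads, with: the GLOBAL inverse `exp i((1/i) log g) = g`,
the log-Lipschitz bound `|(1/i) log g| ≤ (π/2)|g − 1|`, the one-bond bound `|exp(iA) − 1| ≤ |A|`, and the Ad-covariance
`exp i(Ad_g X) = g (exp iX) g⁻¹` — the four hypotheses displayed by the N12 dictionary files (`B15Prop1Carrier.IsCriticalPt.
gaugeAct_of_adCov` (c3′), `B15Prop1ChartDeviation.chartDeviation_of_letters` (ℓ1), dag-n12-c's `B15Prop1GaugeFixing` (X)).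

statement-level skeleton of published theorems with citation tags; proofs where landed; nothing here is a claim about
the Yang–Mills mass gap

Cell pub-ymgap, HUMAN RULING D-0062 (Track A full width), seat `pub-ymgap-dag-n12-c` (R134 acceleration seat (a), strategy s1
of DAG node N12 = [B15]; generation g2, second product).  PDFs held: `paper:balaban1989-cmp122-large-field-i` (journal page =
PDF page + 174), `paper:balaban1989-cmp122-large-field-ii` (journal page = PDF page + 354).

THE PRINT.  [LF-II] p. 359: *«Fixing the gauge G₀ for V′ we get a small configuration, and we can write V′ = exp iB′.»*; p. 360:
*«The field V′ = exp ig_kB is small, more precisely |B| < g_k⁻¹δ′_k»*; [IV] p. 194: *«𝕍_k = V′_kV_k = exp iB′V_k … with B′ ∈ 𝔤ᶜ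
and small, e.g., |B′| < ε»*.  The tree's gauge group is abstract (`Setup.GaugeGroup`, DIVERGENCE F4) and its exponential chart is
DATA (`B16Sect1Backgrounds.ExpChart`: only `exp i0 = 1`, `(1/i) log 1 = 0` recorded), so every use of *«V′ = exp iB′»* in the N12
files carries chart LETTERS: (X) `exp i((1/i) log g) = g` and `|(1/i) log g| ≤ C_ℓ|g − 1|` below a threshold (dag-n12-c
`B15Prop1GaugeFixing.exists_mem_orbit_expMul_norm`), (ℓ1) `|exp(iA(b)) − 1| ≤ κ|A|` (`B15Prop1ChartDeviation`), and the
Ad-covariance of (c3′) (`B15Prop1Carrier.IsCriticalPt.gaugeAct_of_adCov`, HONEST SCOPE (ii) there: *«true for the matrix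
exponential, not assumed of the abstract ExpChart»*).  THIS FILE DISCHARGES ALL FOUR AT `SU(2)` (the cell's instance
`T4CubeChartGnomonic.SU2` = `Matrix.specialUnitaryGroup (Fin 2) ℂ` with `dist1 U = ‖U − 1‖`), from pv26's quaternion calculus BY
NAME: `expPoint_logVec` (onto), `dist1_eq_two_mul_sin` (chord formula), `dist1_expPoint_le`, `mul_quatToSU2_mul` (equivariance).

WHAT THIS FILE PROVES (Mathlib + the two imports; no `sorry`, no `… : Prop` fact, no `instance`, no `notation`; the two `def`s
are model OBJECTS with bodies; axioms standard).
§1 `su2Chart : ExpChart SU2 (EuclideanSpace ℝ (Fin 3))` (`iexp := expPoint`, `ilog U := logVec (su2Quat U)`);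
   `su2Chart_iexp`, `su2Chart_ilog` (`rfl`).
§2 THE LETTERS (X), (ℓ1): `iexp_ilog` (`exp i((1/i) log U) = U` for EVERY `U` — no threshold), `norm_ilog_le_pi`,
   `norm_ilog_le` (`‖(1/i) log U‖ ≤ (π/2)·dist1 U`, Jordan's inequality on the chord `dist1 U = 2 sin(θ/2)`), `dist1_iexp_le`
   (`dist1 (exp iA) ≤ ‖A‖`), and the threshold forms `iexp_ilog_of_lt`, `norm_ilog_le_of_lt` literally as (X) is displayed.
§3 THE Ad-COVARIANCE: `adSU2 g : ℝ³ →ₗ[ℝ] ℝ³` (`X ↦ im(q·ιX·q⁻¹)`, `q = su2Quat g`), `iexp_adSU2` (`exp i(Ad_g X) = g (exp iX) g⁻¹`),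
   and the consequence for the carrier: `isCriticalPt_gaugeAct_su2` — at `G = SU(2)` criticality of a Λ-invariant function
   passes along Λ-orbits with NO covariance hypothesis left ((c3′) of `prop1Printed_lfVarOn_of_model` discharged at `SU(2)`).

HONEST SCOPE.  (i) `SU(2)` only (the cell's concrete group; `SU(N)`/`U(N)` would need the matrix logarithm of
`Summits/Ventures/LatticeQCDFlow/Exactness/MatrixExpChart` — not done here).  (ii) The Lie algebra is `ℝ³` with the Euclidean norm
(`‖ιX‖_ℍ = ‖X‖`); print's `|B′|` is a sup over bonds of a matrix norm — same thing up to the fixed identification `ι`.  (iii) Real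
chart only: the *«analytic extension for 𝔤ᶜ-valued»* `B′` of Proposition 1 is not touched.  Count-neutral; NOT a discharge of
N12; NOT summit progress.
-/

noncomputable section

open Set NormedSpace
open scoped Real Quaternion

namespace Literature.MathematicalPhysics.QuantumFieldTheory.Balaban1983to89.B15Prop1ChartSU2

open Literature.MathematicalPhysics.QuantumLattice (su2Quat quatToSU2 norm_su2Quat quatToSU2_su2Quat su2Quat_ne_zero)
open B16Sect1Backgrounds B15Prop1Carrier B15DeterminingSets GaugeField
open T4CubeChartGnomonic (SU2)
open T4HaarSU2ExpChart (imQuat imQuat_apply imQuat_re norm_imQuat norm_exp_imQuat expPoint expPoint_zero su2Quat_expPoint)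
open T4ExpWindowSmallField (imVec imQuat_imVec logVec norm_logVec norm_logVec_le_pi expPoint_logVec dist1_eq_two_mul_sin
  dist1_expPoint_le)
open T4HaarSU2Translate (su2Quat_mul su2Quat_one mul_quatToSU2_mul)

variable {P : Params}

/-! ## §1 pv26's exponential chart of `SU(2)` as an `ExpChart` datum -/

/-- `logVec 1 = 0` (`im 1 = 0`, `arccos 1 = 0`). [folklore] -/
private theorem logVec_one : logVec (1 : ℍ) = 0 := by
  have h : imVec (1 : ℍ) = 0 := by
    ext i
    fin_cases i <;> simp [imVec]
  simp [logVec, h]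

/-- **THE `SU(2)` EXPONENTIAL CHART** in the format the Proposition-1 carrier reads (`B16Sect1Backgrounds.ExpChart`, p. 360
*«V′ = exp ig_kB»*): `exp iX := expPoint X` (the unit quaternion `exp(ιX)` as a matrix, pv26 `T4HaarSU2ExpChart`) and
`(1/i) log U := logVec (su2Quat U)` (the rotation vector of `U`, pv26 `T4ExpWindowSmallField`), Lie algebra `ℝ³` with the
Euclidean norm. [cite: Balaban1989LargeFieldII, (1.19) p.360] -/
def su2Chart : ExpChart SU2 (EuclideanSpace ℝ (Fin 3)) where
  iexp := expPoint
  ilog U := logVec (su2Quat U)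
  iexp_zero := expPoint_zero
  ilog_one := by
    show logVec (su2Quat (1 : SU2)) = 0
    rw [su2Quat_one, logVec_one]

/-- `su2Chart.iexp = expPoint` (definitional). [cite: Balaban1989LargeFieldII, (1.19) p.360] -/
@[simp] theorem su2Chart_iexp (X : EuclideanSpace ℝ (Fin 3)) : su2Chart.iexp X = expPoint X := rfl

/-- `su2Chart.ilog U = logVec (su2Quat U)` (definitional). [cite: Balaban1989LargeFieldII, (1.16) p.360] -/
@[simp] theorem su2Chart_ilog (U : SU2) : su2Chart.ilog U = logVec (su2Quat U) := rfl

/-! ## §2 The chart letters (X) and (ℓ1) at `SU(2)` -/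

/-- **(X), first half, GLOBALLY**: `exp i((1/i) log U) = U` for every `U ∈ SU(2)` (pv26's `expPoint_logVec`: the chart is onto, the
logarithm a right inverse). [cite: Balaban1989LargeFieldII, p.359 («we can write V′ = exp iB′»)] -/
theorem iexp_ilog (U : SU2) : su2Chart.iexp (su2Chart.ilog U) = U := expPoint_logVec U

/-- `‖(1/i) log U‖ ≤ π` (the rotation half-angle lies in `[0, π]`). [cite: Balaban1989LargeFieldII, (1.16) p.360] -/
theorem norm_ilog_le_pi (U : SU2) : ‖su2Chart.ilog U‖ ≤ π := norm_logVec_le_pi _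

/-- **(X), second half, GLOBALLY**: `‖(1/i) log U‖ ≤ (π/2)·|U − 1|` on `SU(2)` — the chord formula `|U − 1| = 2 sin(θ/2)` with
`θ = ‖(1/i) log U‖ ∈ [0, π]` (pv26 `dist1_eq_two_mul_sin`) and Jordan's inequality `sin x ≥ (2/π)x` on `[0, π/2]`
(`Real.mul_le_sin`). [cite: Balaban1989LargeFieldII, p.360 («The field V′ = exp ig_kB is small, more precisely |B| < g_k⁻¹δ′_k»)] -/
theorem norm_ilog_le (U : SU2) : ‖su2Chart.ilog U‖ ≤ π / 2 * dist1 U := by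
  rw [su2Chart_ilog, dist1_eq_two_mul_sin]
  set θ := ‖logVec (su2Quat U)‖ with hθ
  have h0 : 0 ≤ θ := norm_nonneg _
  have hπ : θ ≤ π := norm_logVec_le_pi _
  have hj : 2 / π * (θ / 2) ≤ Real.sin (θ / 2) :=
    Real.mul_le_sin (by linarith) (by linarith)
  have hpos : 0 < π := Real.pi_pos
  -- `θ = (π/2)·(2/π)·θ ≤ (π/2)·2 sin(θ/2)`
  calc θ = π / 2 * (2 * (2 / π * (θ / 2))) := by field_simp
    _ ≤ π / 2 * (2 * Real.sin (θ / 2)) := by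
        apply mul_le_mul_of_nonneg_left _ (by linarith)
        linarith

/-- **(ℓ1) GLOBALLY**: `|exp(iX) − 1| ≤ ‖X‖` on `SU(2)` (pv26 `dist1_expPoint_le`: `|e^{ιX} − 1| = 2|sin(‖X‖/2)| ≤ ‖X‖`).
[cite: Balaban1989LargeFieldI, Prop. 1 (1.78) p.194] -/
theorem dist1_iexp_le (X : EuclideanSpace ℝ (Fin 3)) : dist1 (su2Chart.iexp X) ≤ ‖X‖ := dist1_expPoint_le X

/-- (X) in the THRESHOLD FORM displayed by `B15Prop1GaugeFixing.exists_mem_orbit_expMul` (any `δc`).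
[cite: Balaban1989LargeFieldII, p.359] -/
theorem iexp_ilog_of_lt (δc : ℝ) : ∀ g : SU2, dist1 g < δc → su2Chart.iexp (su2Chart.ilog g) = g :=
  fun g _ => iexp_ilog g

/-- (X), second half, in the THRESHOLD FORM displayed by `B15Prop1GaugeFixing.exists_mem_orbit_expMul_norm` (`C_ℓ = π/2`, any
`δc`). [cite: Balaban1989LargeFieldII, p.360] -/
theorem norm_ilog_le_of_lt (δc : ℝ) : ∀ g : SU2, dist1 g < δc → ‖su2Chart.ilog g‖ ≤ π / 2 * dist1 g :=
  fun g _ => norm_ilog_le g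

/-- (ℓ1) for a bond field: every chart factor `exp(iA(b))` is within `‖A(b)‖` of `1`, hence within any uniform bound `t` on the
values. [cite: Balaban1989LargeFieldI, Prop. 1 (1.78) p.194] -/
theorem dist1_iexp_apply_le {k : ℕ} (A : VecField P k (EuclideanSpace ℝ (Fin 3))) {t : ℝ} (ht : ∀ b, ‖A b‖ ≤ t) (b : PBond P k) :
    dist1 (su2Chart.iexp (A b)) ≤ t :=
  (dist1_iexp_le (A b)).trans (ht b)

/-! ## §3 The Ad-covariance of the chart and (c3′) at `SU(2)` -/

/-- `imVec` is additive. [folklore] -/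
private theorem imVec_add (p q : ℍ) : imVec (p + q) = imVec p + imVec q := by
  ext i
  fin_cases i <;> simp [imVec]

/-- `imVec` is homogeneous. [folklore] -/
private theorem imVec_smul (c : ℝ) (p : ℍ) : imVec (c • p) = c • imVec p := by
  ext i
  fin_cases i <;> simp [imVec]

/-- `re (a·b) = re (b·a)` in `ℍ`. [folklore] -/
private theorem re_mul_comm (a b : ℍ) : (a * b).re = (b * a).re := by
  simp only [Quaternion.re_mul]
  ring

/-- Conjugating by a non-zero quaternion preserves the real part: `re (q·p·q⁻¹) = re p`. [folklore] -/
private theorem re_conj {q : ℍ} (hq : q ≠ 0) (p : ℍ) : (q * p * q⁻¹).re = p.re := by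
  rw [re_mul_comm, ← mul_assoc, inv_mul_cancel₀ hq, one_mul]

/-- **THE ADJOINT ACTION of `SU(2)` on its Lie algebra `ℝ³`**: `Ad_g X = im(q·ιX·q⁻¹)` with `q = su2Quat g` the unit quaternion of
`g` and `ιX` the pure quaternion of `X` (a rotation of `ℝ³`; linear in `X`). [cite: Balaban1989LargeFieldI, (1.77) p.194] -/
def adSU2 (g : SU2) : EuclideanSpace ℝ (Fin 3) →ₗ[ℝ] EuclideanSpace ℝ (Fin 3) where
  toFun X := imVec (su2Quat g * imQuat X * (su2Quat g)⁻¹)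
  map_add' X Y := by rw [map_add, mul_add, add_mul, imVec_add]
  map_smul' c X := by
    rw [map_smul, RingHom.id_apply, ← imVec_smul, mul_smul_comm, smul_mul_assoc]

/-- `adSU2` unfolded. [cite: Balaban1989LargeFieldI, (1.77) p.194] -/
theorem adSU2_apply (g : SU2) (X : EuclideanSpace ℝ (Fin 3)) :
    adSU2 g X = imVec (su2Quat g * imQuat X * (su2Quat g)⁻¹) := rfl

/-- `ι(Ad_g X) = q·ιX·q⁻¹`: the conjugate of a pure quaternion is pure. [folklore] -/
private theorem imQuat_adSU2 (g : SU2) (X : EuclideanSpace ℝ (Fin 3)) :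
    imQuat (adSU2 g X) = su2Quat g * imQuat X * (su2Quat g)⁻¹ := by
  rw [adSU2_apply, imQuat_imVec]
  set p := su2Quat g * imQuat X * (su2Quat g)⁻¹ with hp
  have hre : p.re = 0 := by rw [hp, re_conj (su2Quat_ne_zero g), imQuat_re]
  have := Quaternion.re_add_im p
  rw [hre] at this
  simpa using this

/-- `su2Quat g⁻¹ = (su2Quat g)⁻¹`. [folklore] -/
private theorem su2Quat_inv (g : SU2) : su2Quat g⁻¹ = (su2Quat g)⁻¹ := by
  have h : su2Quat g * su2Quat g⁻¹ = 1 := by rw [← su2Quat_mul, mul_inv_cancel, su2Quat_one]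
  exact eq_inv_of_mul_eq_one_right h

/-- `Ad_g` is an isometry of `ℝ³` (`‖q·ιX·q⁻¹‖ = ‖ιX‖ = ‖X‖` for the unit quaternion `q`). [folklore] -/
private theorem norm_adSU2 (g : SU2) (X : EuclideanSpace ℝ (Fin 3)) : ‖adSU2 g X‖ = ‖X‖ := by
  rw [← norm_imQuat (adSU2 g X), imQuat_adSU2, norm_mul, norm_mul, norm_inv, norm_su2Quat, norm_imQuat]
  simp

/-- Conjugation commutes with the exponential of a pure quaternion: `exp(q·ιX·q⁻¹) = q·exp(ιX)·q⁻¹` — from pv26's closed form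
`exp(ιY) = cos‖Y‖ + sinc‖Y‖·ιY` (`T4HaarSU2ExpChart.exp_imQuat`) at `Y = Ad_g X`, `‖Ad_g X‖ = ‖X‖`, real scalars being central.
[folklore] -/
private theorem exp_imQuat_adSU2 (g : SU2) (X : EuclideanSpace ℝ (Fin 3)) :
    exp (imQuat (adSU2 g X)) = su2Quat g * exp (imQuat X) * (su2Quat g)⁻¹ := by
  have hq : su2Quat g ≠ 0 := su2Quat_ne_zero g
  rw [T4HaarSU2ExpChart.exp_imQuat, T4HaarSU2ExpChart.exp_imQuat, norm_adSU2, imQuat_adSU2]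
  rw [mul_add, add_mul, mul_smul_comm, smul_mul_assoc, ← Quaternion.coe_commutes (Real.cos ‖X‖) (su2Quat g),
    mul_inv_cancel_right₀ hq]

/-- **Ad-COVARIANCE OF THE CHART**: `exp i(Ad_g X) = g·(exp iX)·g⁻¹` on `SU(2)` — conjugation commutes with the exponential of a
pure quaternion and with the projection `quatToSU2` (pv26 `mul_quatToSU2_mul`).  This is the hypothesis `had` of
`B15Prop1Carrier.IsCriticalPt.gaugeAct_of_adCov`. [cite: Balaban1989LargeFieldI, (1.77) p.194 («invariant with respect to the group
of all gauge transformations defined on Λ»)] -/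
theorem iexp_adSU2 (g : SU2) (X : EuclideanSpace ℝ (Fin 3)) :
    su2Chart.iexp (adSU2 g X) = g * su2Chart.iexp X * g⁻¹ := by
  have hne : exp (imQuat X) ≠ 0 := by
    intro h; have := norm_exp_imQuat X; rw [h, norm_zero] at this; exact zero_ne_one this
  rw [su2Chart_iexp, su2Chart_iexp, expPoint, expPoint, exp_imQuat_adSU2, mul_quatToSU2_mul g g⁻¹ hne, su2Quat_inv]

variable {k : ℕ}

/-- **(c3′) AT `SU(2)` WITH NO COVARIANCE HYPOTHESIS LEFT.**  For a function `f` of the configurations invariant under the gauge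
transformations defined on `S` and any `u` defined on `S`: if `V` is a critical configuration (through the `SU(2)` chart, in the
directions supported on `Λb`) then so is `V^u` — the carrier's `IsCriticalPt.gaugeAct_of_adCov` with `had` discharged by
`iexp_adSU2`.  [IV] p. 194: *«The function is invariant with respect to the group of all gauge transformations defined on Λ, hence
it is natural to consider it on orbits of this group»*; [LF-II] p. 359 *«critical configuration»*. [cite: Balaban1989LargeFieldI,
Prop. 1 (1.77) p.194; Balaban1989LargeFieldII, (1.12) p.359] -/
theorem isCriticalPt_gaugeAct_su2 {S : Set (Site P k)} {Λb : Set (PBond P k)} {f : GaugeField P k SU2 → ℝ}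
    (hf : ∀ u : GaugeTransf P k SU2, IsGaugeOn S u → ∀ V, f (gaugeAct u V) = f V) {u : GaugeTransf P k SU2}
    (hu : IsGaugeOn S u) {V : GaugeField P k SU2} (hV : IsCriticalPt su2Chart Λb f V) :
    IsCriticalPt su2Chart Λb f (gaugeAct u V) :=
  hV.gaugeAct_of_adCov su2Chart adSU2 iexp_adSU2 hf hu

end Literature.MathematicalPhysics.QuantumFieldTheory.Balaban1983to89.B15Prop1ChartSU2

end
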